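import Mathlib
import HarnessLib

/-!
# Finite Jensen for `t ↦ t ^ c`, `0 < c ≤ 1`, with sub-probability weights

Stub `stub_finiteJensen` of line `SketchR2I5` for the crux `PercNearOneGluing.NearOneGluing`
(item stmt-CriticalPhenomena-4574).  Pure Mathlib: concavity of `Real.rpow` with exponent in `[0,1]`
(`Real.concaveOn_rpow`) and the concave Jensen inequality with a distinguished point
(`ConcaveOn.map_add_sum_le`), the distinguished point being `0` carrying the slack weight `1 - Σ m i`.
-/

namespace Summit.CriticalPhenomena.PercolationContinuityZ3.Theorems

open scoped BigOperators

/-- **Finite Jensen, sub-probability form.** For nonnegative weights `m i` with `Σ m i ≤ 1`,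
nonnegative `x i` and `0 < c ≤ 1`: `Σ m i · (x i)^c ≤ (Σ m i · x i)^c`.
Proof: Jensen for the concave `t ↦ t ^ c` on `[0, ∞)` (`Real.concaveOn_rpow`) with the probability
weights `(1 - Σ m i, m)` at the points `(0, x)` (`ConcaveOn.map_add_sum_le`); the extra term is
`(1 - Σ m i) · 0 ^ c = 0` because `c ≠ 0`. -/
theorem stub_finiteJensen :
    ∀ {ι : Type*} (s : Finset ι) (m x : ι → ℝ) (c : ℝ), 0 < c → c ≤ 1 →
      (∀ i ∈ s, 0 ≤ m i) → (∑ i ∈ s, m i ≤ 1) → (∀ i ∈ s, 0 ≤ x i) →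
        ∑ i ∈ s, m i * (x i) ^ c ≤ (∑ i ∈ s, m i * x i) ^ c := by
  intro ι s m x c hc0 hc1 hm hsum hx
  have h := (Real.concaveOn_rpow hc0.le hc1).map_add_sum_le (t := s) (w := m) (p := x)
    (v := 1 - ∑ i ∈ s, m i) (q := 0) hm (by ring) (fun i hi => Set.mem_Ici.2 (hx i hi))
    (sub_nonneg.2 hsum) (Set.mem_Ici.2 le_rfl)
  simpa [Real.zero_rpow hc0.ne', smul_eq_mul] using h

end Summit.CriticalPhenomena.PercolationContinuityZ3.Theorems
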